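import Summits.Schanuel.Schanuel.Theorems.DiophantineDichotomyKhovanskiiApproxTypeEvLambertExpOneDegreeMeasure
import Summits.Schanuel.Schanuel.Theorems.DiophantineDichotomyKhovanskiiApproxTypeEvPairSumCoeffBound
import HarnessLib

/-!
# Crux `DiophantineDichotomy.KhovanskiiApproxTypeEv` (stmt-Schanuel-14972), line `Sketch` — stub `stub_minimalClause`

The MINIMAL-CLAUSE bookkeeping step of the print side of the hardness certificate of the
Lindemann–Weierstrass leaf: an arbitrary integer clause `S` at `z` (`S ≠ 0`, `S(z) = 0`,
`deg S ≤ D`, coefficients bounded by `A`) is replaced by a clause `R` at `z` that is IRREDUCIBLE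
over `ℚ`, of degree `1 ≤ deg R ≤ D`, with controlled naive height `|coeff R| ≤ 2^D (D+1) A`.
Proof: some irreducible factor `R` of `S` in the UFD `ℤ[X]` vanishes at `z` and has `M(R) ≤ M(S)`
(`LambertLiouvilleKill.exists_irreducible_factor_of_aeval_eq_zero`); then
`|coeff_l R| ≤ C(deg R, l) M(R) ≤ 2^{deg R} M(S) ≤ 2^D (deg S + 1) A ≤ 2^D (D+1) A`
(`Polynomial.norm_coeff_le_choose_mul_mahlerMeasure`, `Nat.choose_le_two_pow`,
`mahlerMeasure_map_le_of_coeff_le`).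
-/

noncomputable section

set_option linter.dupNamespace false
-- mandated summit/sub-problem namespace (single-conjunct summit)

namespace Summit.Schanuel.Schanuel.Cruxes.KhovanskiiApproxTypeEv.AnchoredReduction

open Polynomial
open Summit.Schanuel.Schanuel.Cruxes.KhovanskiiApproxTypeEv.LambertLiouvilleKill

/-- Gel'fond–Mahler coefficient bound for an integer polynomial:
`|coeff_l R| ≤ C(deg R, l) · M(R ⊗ ℂ) ≤ 2^{deg R} · M(R ⊗ ℂ)`. [folklore] -/
theorem abs_coeff_le_two_pow_mul_mahlerMeasure (R : ℤ[X]) (l : ℕ) :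
    |(R.coeff l : ℝ)| ≤ 2 ^ R.natDegree * (R.map (Int.castRingHom ℂ)).mahlerMeasure := by
  have hdeg : (R.map (Int.castRingHom ℂ)).natDegree = R.natDegree :=
    natDegree_map_eq_of_injective (Int.castRingHom ℂ).injective_int R
  have hnorm : ‖(R.map (Int.castRingHom ℂ)).coeff l‖ = |(R.coeff l : ℝ)| := by
    rw [coeff_map, eq_intCast, Complex.norm_intCast]
  have h1 := norm_coeff_le_choose_mul_mahlerMeasure l (R.map (Int.castRingHom ℂ))
  rw [hnorm, hdeg] at h1
  have h2 : ((R.natDegree.choose l : ℕ) : ℝ) ≤ 2 ^ R.natDegree := by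
    exact_mod_cast Nat.choose_le_two_pow _ _
  exact h1.trans (mul_le_mul_of_nonneg_right h2 (mahlerMeasure_nonneg _))

/-- SUB-GOAL (worker): the MINIMAL-CLAUSE step — replace an arbitrary integer clause `S` at `z`
(`S ≠ 0`, `deg S ≤ D`, coefficients `≤ A`) by an IRREDUCIBLE-over-`ℚ` clause `R` at `z` with
`1 ≤ deg R ≤ D` and `|coeff R| ≤ 2^D (D+1) A` (an irreducible factor of `S` in the UFD `ℤ[X]`
vanishing at `z`, `M(R) ≤ M(S)`; `|coeff_l R| ≤ C(deg R, l) M(R) ≤ 2^{deg R} M(S) ≤ 2^D (deg S + 1) A`).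
[folklore] -/
theorem stub_minimalClause (z : ℂ) (D A : ℕ) (S : Polynomial ℤ) (hS : S ≠ 0) (hdeg : S.natDegree ≤ D)
    (hA : ∀ l, |S.coeff l| ≤ (A : ℤ)) (hz : Polynomial.aeval z S = 0) :
    ∃ R : Polynomial ℤ, Irreducible (R.map (Int.castRingHom ℚ)) ∧ Polynomial.aeval z R = 0 ∧
      1 ≤ R.natDegree ∧ R.natDegree ≤ D ∧ ∀ l, |R.coeff l| ≤ ((2 ^ D * (D + 1) * A : ℕ) : ℤ) := by
  obtain ⟨R, hirr, hroot, h1, hle, hM⟩ := exists_irreducible_factor_of_aeval_eq_zero hS hz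
  have hRD : R.natDegree ≤ D := hle.trans hdeg
  refine ⟨R, hirr, hroot, h1, hRD, fun l => ?_⟩
  have hMS : (S.map (Int.castRingHom ℂ)).mahlerMeasure ≤ ((S.natDegree : ℝ) + 1) * A :=
    mahlerMeasure_map_le_of_coeff_le S A hA
  have hSD : (S.natDegree : ℝ) ≤ D := by exact_mod_cast hdeg
  have hreal : |(R.coeff l : ℝ)| ≤ 2 ^ D * ((D : ℝ) + 1) * A :=
    calc |(R.coeff l : ℝ)| ≤ 2 ^ R.natDegree * (R.map (Int.castRingHom ℂ)).mahlerMeasure :=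
          abs_coeff_le_two_pow_mul_mahlerMeasure R l
      _ ≤ 2 ^ D * (((S.natDegree : ℝ) + 1) * A) :=
          mul_le_mul (pow_le_pow_right₀ (by norm_num) hRD) (hM.trans hMS) (mahlerMeasure_nonneg _)
            (by positivity)
      _ ≤ 2 ^ D * (((D : ℝ) + 1) * A) := by gcongr
      _ = 2 ^ D * ((D : ℝ) + 1) * A := by ring
  have hint : ((|R.coeff l| : ℤ) : ℝ) ≤ (((2 ^ D * (D + 1) * A : ℕ) : ℤ) : ℝ) := by
    push_cast
    exact hreal
  exact Int.cast_le.mp hint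

end Summit.Schanuel.Schanuel.Cruxes.KhovanskiiApproxTypeEv.AnchoredReduction

end
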